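import Mathlib
import HarnessLib
import Summits.Ventures.LatticeQCDFlow.Exactness.SUNResidualExponentLipschitz
import Summits.Ventures.LatticeQCDFlow.Exactness.SUNResidualLayerEquiv

/-!
# The engine's residual coupling layer as shipped — polynomial staple weights from a continuous conditioner of the frozen context — is a homeomorphism and a measurable equivalence of `SU(N)^E`, every `N`, whenever `contraction_bound < 1` at every active link

HONEST FRAMING: exact (Metropolis-corrected) sampling algorithms for lattice gauge theory;
figures of merit are autocorrelation/cost numbers at stated couplings and volumes; no
continuum-physics claim.

Venture `LatticeQCDFlow` (cell pub-lqcd), topic `Exactness`; FANOUT row 10 (`eng-equiv`, engine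
`latflow.equiv`, module `equiv/residual.py`: `ResidualCoupling` = "Map on ACTIVE links
`U_l → exp(Q_l(U_l)) U_l`, `Q_l(U) = Σ_j g_j(c_j) A_j`, `A_j = −TA(U C_j)`, `c_j = Re tr(U C_j)/N`,
… `g_j(c) = Σ_k a_{j,k} c^k` … coefficients `a_{j,k}(x)` are constants, a defect-localised profile,
or functions of gauge-invariant FROZEN context (conditioner)", with the guard
"`kappa(x) := Σ_j Σ_k (1 + k)|a_{j,k}(x)|` … `forward`/`inverse` REFUSE (NonBijectiveLayer) when
`kappa_max >= kappa_limit` (default 1)"; `flows_jax.residual_flow`, "κ < 1 by construction").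
NEW WORK of the cell, the capstone of `SUNResidualLayerContraction.lean` (one link, abstract
certificate), `SUNResidualExponentLipschitz.lean` (the engine's exponent meets the certificate
with `κ = contraction_bound`) and `SUNResidualLayerEquiv.lean` (coupling layers with bijective
continuous fibres are homeomorphisms / measurable equivalences); nothing is cited as a fact; no
number; no definition is introduced.  Printed counterparts, NAMED ONLY: Abbott et al.,
arXiv:2305.02402 §4.2.1; Lüscher, CMP 293 (2010) 899, App. D.

## What is typed (`n` arbitrary; links `ι` with mask `p`; staples indexed by a finite type `σ`; degree `< K`)

Data, all read from the FROZEN links `y`: staples `C a j y ∈ U(n)` (continuous in `y` — in the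
engine, products of three frozen links) and real coefficients `acoef a j k y` (continuous in `y` —
constants, a defect profile, or a conditioner's output).  The layer replaces each active link
`u_a` by `e^{Q_a(y, u_a)} u_a`,
`Q_a(y, u) = Σ_j (Σ_{k<K} acoef a j k y · (Re tr(u C a j y)/n)^k) • (−P(u C a j y))`.

* `continuous_suProj`, **`continuous_engineResidualExponent`** — the exponent is jointly
  continuous in (link, frozen context);
* **`engineResidualCouplingLayer_bijective`** — if `Σ_j Σ_{k<K} (1 + k)|acoef a j k y| < 1` for
  every active link `a` and frozen context `y` (the guard, checked per call), the layer is a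
  bijection of `ι → SU(n)`;
* **`isHomeomorph_engineResidualCouplingLayer`** — with continuous staples and coefficients it is
  a homeomorphism of `SU(n)^ι`;
* **`exists_measurableEquiv_engineResidualCouplingLayer`** — and (countable `ι`) there is a
  measurable equivalence of `SU(n)^ι` whose forward map IS the layer: the learned `SU(N)` residual
  layers are bijective measurable transport maps with measurable inverse, for every `N` (the
  tree had `N = 2`, `SU2ResidualLayer.exists_measurableEquiv_su2ResidualLayer`).

NOT here: the Jacobian `|det(1 + Φ_Q ∘ DQ)|`; that the engine's direction / location masks make
every staple frozen (the datum `C a j` reads frozen links only BY TYPE here); any number.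
-/

noncomputable section

namespace Summit.Ventures.LatticeQCDFlow.Exactness

open Literature.MathematicalPhysics.QuantumFieldTheory
open Literature.MathematicalPhysics.QuantumFieldTheory.Luscher2010
open scoped Matrix

variable {n : ℕ}

/-! ## Continuity of the engine's exponent in (link, frozen context) -/

/-- **`P = suProj` is continuous** (a real-linear map of a finite-dimensional space, written out:
`½(W − Wᴴ) − (tr(W − Wᴴ)/2n) • 1`). -/
theorem continuous_suProj : Continuous (suProj (n := n)) := by
  have h1 : Continuous fun W : Matrix (Fin n) (Fin n) ℂ => W - Wᴴ :=
    continuous_id.sub continuous_id.matrix_conjTranspose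
  unfold suProj
  exact (h1.const_smul (1 / 2 : ℂ)).sub ((continuous_const.mul h1.matrix_trace).smul continuous_const)

/-- **The engine's exponent is jointly continuous in (link, frozen context)**: for staples
`C j : Y → Matrix` and coefficients `acoef j k : Y → ℝ` continuous in the context `y ∈ Y`,
`(u, y) ↦ Σ_j (Σ_{k<K} acoef j k y · (Re tr(u C j y)/n)^k) • (−P(u C j y))` is continuous on
`SU(n) × Y`. -/
theorem continuous_engineResidualExponent {Y : Type*} [TopologicalSpace Y] {σ : Type*} [Fintype σ]
    (K : ℕ) {C : σ → Y → Matrix (Fin n) (Fin n) ℂ} (hC : ∀ j, Continuous (C j))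
    {acoef : σ → ℕ → Y → ℝ} (ha : ∀ j k, Continuous (acoef j k)) :
    Continuous fun q : Matrix.specialUnitaryGroup (Fin n) ℂ × Y =>
      ∑ j, ((∑ k ∈ Finset.range K, acoef j k q.2 *
          (((q.1 : Matrix (Fin n) (Fin n) ℂ) * C j q.2).trace.re / n) ^ k : ℝ) : ℂ) •
        (-suProj ((q.1 : Matrix (Fin n) (Fin n) ℂ) * C j q.2)) := by
  refine continuous_finsetSum _ fun j _ => ?_
  have hW : Continuous fun q : Matrix.specialUnitaryGroup (Fin n) ℂ × Y =>
      (q.1 : Matrix (Fin n) (Fin n) ℂ) * C j q.2 :=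
    (continuous_subtype_val.comp continuous_fst).mul ((hC j).comp continuous_snd)
  have hc : Continuous fun q : Matrix.specialUnitaryGroup (Fin n) ℂ × Y =>
      ((q.1 : Matrix (Fin n) (Fin n) ℂ) * C j q.2).trace.re / n :=
    (Complex.continuous_re.comp hW.matrix_trace).div_const _
  have hg : Continuous fun q : Matrix.specialUnitaryGroup (Fin n) ℂ × Y =>
      ∑ k ∈ Finset.range K, acoef j k q.2 *
        (((q.1 : Matrix (Fin n) (Fin n) ℂ) * C j q.2).trace.re / n) ^ k :=
    continuous_finsetSum _ fun k _ => ((ha j k).comp continuous_snd).mul (hc.pow k)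
  exact (Complex.continuous_ofReal.comp hg).smul (continuous_suProj.comp hW).neg

/-! ## The layer: bijection, homeomorphism, measurable equivalence -/

section Layer

variable {ι : Type*} {p : ι → Prop} [DecidablePred p] {σ : Type*} [Fintype σ]

/-- **The engine's residual coupling layer is a bijection of `ι → SU(n)`, every `n`**, whenever
`Σ_j Σ_{k<K} (1 + k)|acoef a j k y| < 1` at every active link for every frozen context (unitary
staples). -/
theorem engineResidualCouplingLayer_bijective (K : ℕ)
    (C : {i // p i} → σ → ({i // ¬p i} → Matrix.specialUnitaryGroup (Fin n) ℂ) → Matrix (Fin n) (Fin n) ℂ)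
    (hCu : ∀ a j y, C a j y ∈ Matrix.unitaryGroup (Fin n) ℂ)
    (acoef : {i // p i} → σ → ℕ → ({i // ¬p i} → Matrix.specialUnitaryGroup (Fin n) ℂ) → ℝ)
    (hκ : ∀ a y, ∑ j, ∑ k ∈ Finset.range K, (1 + (k : ℝ)) * |acoef a j k y| < 1) :
    Function.Bijective (Theory2.coupleFun p fun a y (u : Matrix.specialUnitaryGroup (Fin n) ℂ) =>
      (⟨NormedSpace.exp (∑ j, ((∑ k ∈ Finset.range K, acoef a j k y *
            (((u : Matrix (Fin n) (Fin n) ℂ) * C a j y).trace.re / n) ^ k : ℝ) : ℂ) •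
          (-suProj ((u : Matrix (Fin n) (Fin n) ℂ) * C a j y))) * u,
        residual_value_mem (fun U _ => residualExponent_skew (fun j k => acoef a j k y) K
          (fun j => C a j y) U) u.2⟩ : Matrix.specialUnitaryGroup (Fin n) ℂ)) :=
  sunResidualLayer_bijective _ (fun a y => ∑ j, ∑ k ∈ Finset.range K, (1 + (k : ℝ)) * |acoef a j k y|)
    (fun a y U _ => residualExponent_skew (fun j k => acoef a j k y) K (fun j => C a j y) U)
    (fun a y _ hU _ hV => frobNorm_residualExponent_sub_le (fun j k => acoef a j k y) K (hCu a · y)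
      (Matrix.mem_specialUnitaryGroup_iff.mp hU).1 (Matrix.mem_specialUnitaryGroup_iff.mp hV).1)
    (fun a y => contractionBound_nonneg (fun j k => acoef a j k y) K) hκ

/-- **The engine's residual coupling layer is a HOMEOMORPHISM of `SU(n)^ι`** when, in addition,
staples and coefficients depend continuously on the frozen links. -/
theorem isHomeomorph_engineResidualCouplingLayer (K : ℕ)
    (C : {i // p i} → σ → ({i // ¬p i} → Matrix.specialUnitaryGroup (Fin n) ℂ) → Matrix (Fin n) (Fin n) ℂ)
    (hCu : ∀ a j y, C a j y ∈ Matrix.unitaryGroup (Fin n) ℂ) (hCc : ∀ a j, Continuous (C a j))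
    (acoef : {i // p i} → σ → ℕ → ({i // ¬p i} → Matrix.specialUnitaryGroup (Fin n) ℂ) → ℝ)
    (hac : ∀ a j k, Continuous (acoef a j k))
    (hκ : ∀ a y, ∑ j, ∑ k ∈ Finset.range K, (1 + (k : ℝ)) * |acoef a j k y| < 1) :
    IsHomeomorph (Theory2.coupleFun p fun a y (u : Matrix.specialUnitaryGroup (Fin n) ℂ) =>
      (⟨NormedSpace.exp (∑ j, ((∑ k ∈ Finset.range K, acoef a j k y *
            (((u : Matrix (Fin n) (Fin n) ℂ) * C a j y).trace.re / n) ^ k : ℝ) : ℂ) •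
          (-suProj ((u : Matrix (Fin n) (Fin n) ℂ) * C a j y))) * u,
        residual_value_mem (fun U _ => residualExponent_skew (fun j k => acoef a j k y) K
          (fun j => C a j y) U) u.2⟩ : Matrix.specialUnitaryGroup (Fin n) ℂ)) :=
  isHomeomorph_sunResidualLayer _
    (fun a y => ∑ j, ∑ k ∈ Finset.range K, (1 + (k : ℝ)) * |acoef a j k y|)
    (fun a y U _ => residualExponent_skew (fun j k => acoef a j k y) K (fun j => C a j y) U)
    (fun a y _ hU _ hV => frobNorm_residualExponent_sub_le (fun j k => acoef a j k y) K (hCu a · y)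
      (Matrix.mem_specialUnitaryGroup_iff.mp hU).1 (Matrix.mem_specialUnitaryGroup_iff.mp hV).1)
    (fun a y => contractionBound_nonneg (fun j k => acoef a j k y) K) hκ
    fun a => continuous_engineResidualExponent K (hCc a) (hac a)

/-- **… and a measurable equivalence of `SU(n)^ι` whose forward map IS the layer** (countable
link set): the learned `SU(N)` residual layers of the engine are bijective, measurable in both
directions — for every `N`. -/
theorem exists_measurableEquiv_engineResidualCouplingLayer [Countable ι] (K : ℕ)
    (C : {i // p i} → σ → ({i // ¬p i} → Matrix.specialUnitaryGroup (Fin n) ℂ) → Matrix (Fin n) (Fin n) ℂ)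
    (hCu : ∀ a j y, C a j y ∈ Matrix.unitaryGroup (Fin n) ℂ) (hCc : ∀ a j, Continuous (C a j))
    (acoef : {i // p i} → σ → ℕ → ({i // ¬p i} → Matrix.specialUnitaryGroup (Fin n) ℂ) → ℝ)
    (hac : ∀ a j k, Continuous (acoef a j k))
    (hκ : ∀ a y, ∑ j, ∑ k ∈ Finset.range K, (1 + (k : ℝ)) * |acoef a j k y| < 1) :
    ∃ e : (ι → Matrix.specialUnitaryGroup (Fin n) ℂ) ≃ᵐ (ι → Matrix.specialUnitaryGroup (Fin n) ℂ),
      ⇑e = Theory2.coupleFun p fun a y (u : Matrix.specialUnitaryGroup (Fin n) ℂ) =>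
        (⟨NormedSpace.exp (∑ j, ((∑ k ∈ Finset.range K, acoef a j k y *
              (((u : Matrix (Fin n) (Fin n) ℂ) * C a j y).trace.re / n) ^ k : ℝ) : ℂ) •
            (-suProj ((u : Matrix (Fin n) (Fin n) ℂ) * C a j y))) * u,
          residual_value_mem (fun U _ => residualExponent_skew (fun j k => acoef a j k y) K
            (fun j => C a j y) U) u.2⟩ : Matrix.specialUnitaryGroup (Fin n) ℂ) :=
  exists_measurableEquiv_sunResidualLayer _
    (fun a y => ∑ j, ∑ k ∈ Finset.range K, (1 + (k : ℝ)) * |acoef a j k y|)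
    (fun a y U _ => residualExponent_skew (fun j k => acoef a j k y) K (fun j => C a j y) U)
    (fun a y _ hU _ hV => frobNorm_residualExponent_sub_le (fun j k => acoef a j k y) K (hCu a · y)
      (Matrix.mem_specialUnitaryGroup_iff.mp hU).1 (Matrix.mem_specialUnitaryGroup_iff.mp hV).1)
    (fun a y => contractionBound_nonneg (fun j k => acoef a j k y) K) hκ
    fun a => continuous_engineResidualExponent K (hCc a) (hac a)

end Layer

end Summit.Ventures.LatticeQCDFlow.Exactness
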